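import Literature.Probability.Distributions.GaussianSphereMarginal
import Literature.Probability.Distributions.ComplexGaussianVectors
import Mathlib.Analysis.InnerProductSpace.PiL2
import Mathlib.LinearAlgebra.Complex.FiniteDimensional
import Mathlib.RingTheory.Norm.Transitivity
import Mathlib.RingTheory.Complex
import HarnessLib

/-!
# The conditional law of a new column of a Haar-unitary corner

`Literature/Probability/RandomMatrix/`. The analytic step of the column-by-column computation of
the law of a `p × q` corner of a Haar unitary (`HaarCornerDensity.lean`). Conditionally on the
previous columns, the new column of the corner is `a = ‖c‖⁻¹ · N c` where `c` is a standard
Gaussian vector of `ℂ^M` (`M = m - q`, the coordinates of the Gram–Schmidt residual in an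
orthonormal basis of the orthogonal complement of the previous columns) and `N` is a `p × M`
matrix (the top `p` rows of that basis) with `N N* = C`, the Gram complement `1 - ∑ⱼ aⱼ aⱼ*` of
the previous columns of the corner. The theorem `map_normalizeMulVec_stdGaussian`: if `C = N N*`
is positive definite and `M ≥ p + 1`, the law of `‖c‖⁻¹ · N c` is

`K · (det C)⁻¹ (1 - a* C⁻¹ a)^{M-p-1} 𝟙_{a* C⁻¹ a < 1} da` on `ℂ^p`

(`condDensity`), with a constant `K > 0` depending only on `p` and `M`.

## Proof

Split `ℂ^M = (ker N)ᗮ ⊕ ker N` with an adapted orthonormal basis (`Submodule.sumOrthonormalBasis`;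
`dim ker N = M - p` since `N N*` is invertible): the coordinates `(u, w)` of `c` are independent
standard Gaussians (`map_euclSplit_repr_stdGaussian`), `N c = N' u` for the invertible `p × p`
matrix `N'` of `N` on `(ker N)ᗮ` (`reduce`, with `N' N'* = N N*` by completeness of the basis),
and `‖c‖² = ‖u‖² + ‖w‖²`; so `a = N' (u / √(‖u‖² + ‖w‖²))` is the image under `N'` of the sphere
marginal, whose law is `K (1 - ‖b‖²)^{M-p-1} 𝟙_{‖b‖<1} db`
(`map_sphereMarginalMap_prod_stdGaussian`, real dimension `2(M - p)`); the linear change of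
variables `a = N' b` has real Jacobian `|det N'|² = det C` and `‖N'⁻¹ a‖² = a* C⁻¹ a`.
All [folklore].
-/

noncomputable section

open MeasureTheory ProbabilityTheory Set Module Matrix Complex
open Literature.Probability.Distributions
open scoped ENNReal ComplexOrder InnerProductSpace

namespace Literature.Probability.RandomMatrix

/-! ### Invertible matrices acting on `ℂ^p`: determinant, volume, inverse norm -/

section Square

variable {p : ℕ}

/-- `det (x ↦ N x on ℂ^p) = det N`. [folklore] -/
theorem det_toEuclideanLin (N : Matrix (Fin p) (Fin p) ℂ) :
    LinearMap.det (toEuclideanLin N) = N.det := by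
  rw [toEuclideanLin_eq_toLin_orthonormal]
  exact LinearMap.det_toLin _ N

/-- The real determinant of `x ↦ N x` on `ℂ^p ≅ ℝ^{2p}` is `|det N|²`. [folklore] -/
theorem det_restrictScalars_toEuclideanLin (N : Matrix (Fin p) (Fin p) ℂ) :
    LinearMap.det ((toEuclideanLin N).restrictScalars ℝ) = Complex.normSq N.det := by
  rw [LinearMap.det_restrictScalars, Algebra.norm_complex_apply, det_toEuclideanLin]

/-- **Linear change of variables on `ℂ^p`**: an invertible matrix `N` maps Lebesgue measure to
`|det N|⁻² ·` Lebesgue measure. [folklore] -/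
theorem map_toEuclideanLin_volume (N : Matrix (Fin p) (Fin p) ℂ) (hN : N.det ≠ 0) :
    (volume : Measure (EuclideanSpace ℂ (Fin p))).map (toEuclideanLin N) =
      ENNReal.ofReal ((Complex.normSq N.det)⁻¹) • volume := by
  have hdet : LinearMap.det ((toEuclideanLin N).restrictScalars ℝ) ≠ 0 := by
    rw [det_restrictScalars_toEuclideanLin]
    exact (Complex.normSq_pos.2 hN).ne'
  have h := Measure.map_linearMap_addHaar_eq_smul_addHaar
    (volume : Measure (EuclideanSpace ℂ (Fin p))) hdet
  rw [det_restrictScalars_toEuclideanLin, abs_of_nonneg (inv_nonneg.2 (Complex.normSq_nonneg _))] at h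
  exact h

/-- Transport of a density along a measurable equivalence:
`e_* (μ.withDensity f) = (e_* μ).withDensity (f ∘ e⁻¹)`. [folklore] -/
theorem map_withDensity_measurableEquiv {α β : Type*} [MeasurableSpace α] [MeasurableSpace β]
    (μ : Measure α) (e : α ≃ᵐ β) (f : α → ℝ≥0∞) :
    (μ.withDensity f).map e = (μ.map e).withDensity (f ∘ e.symm) := by
  ext s hs
  rw [Measure.map_apply e.measurable hs, withDensity_apply _ (e.measurable hs),
    withDensity_apply _ hs, Measure.restrict_map e.measurable hs, lintegral_map_equiv]
  simp only [Function.comp_apply, e.symm_apply_apply]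

/-- An invertible matrix as a linear automorphism of `ℂ^p`. [folklore] -/
def euclLinEquiv (N : Matrix (Fin p) (Fin p) ℂ) (hN : N.det ≠ 0) :
    EuclideanSpace ℂ (Fin p) ≃ₗ[ℂ] EuclideanSpace ℂ (Fin p) :=
  LinearMap.equivOfDetNeZero (toEuclideanLin N) (by rwa [det_toEuclideanLin])

/-- `euclLinEquiv N` acts as `x ↦ N x`. [folklore] -/
@[simp] theorem euclLinEquiv_apply (N : Matrix (Fin p) (Fin p) ℂ) (hN : N.det ≠ 0)
    (x : EuclideanSpace ℂ (Fin p)) : euclLinEquiv N hN x = WithLp.toLp 2 (N *ᵥ x.ofLp) := rfl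

/-- The same automorphism as a measurable equivalence. [folklore] -/
def euclMeasurableEquiv (N : Matrix (Fin p) (Fin p) ℂ) (hN : N.det ≠ 0) :
    EuclideanSpace ℂ (Fin p) ≃ᵐ EuclideanSpace ℂ (Fin p) :=
  (euclLinEquiv N hN).toContinuousLinearEquiv.toHomeomorph.toMeasurableEquiv

/-- The measurable equivalence acts as `x ↦ N x`. [folklore] -/
@[simp] theorem euclMeasurableEquiv_apply (N : Matrix (Fin p) (Fin p) ℂ) (hN : N.det ≠ 0)
    (x : EuclideanSpace ℂ (Fin p)) : euclMeasurableEquiv N hN x = WithLp.toLp 2 (N *ᵥ x.ofLp) := rfl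

/-- Its inverse is the inverse of the linear automorphism. [folklore] -/
theorem euclMeasurableEquiv_symm_apply (N : Matrix (Fin p) (Fin p) ℂ) (hN : N.det ≠ 0)
    (a : EuclideanSpace ℂ (Fin p)) : (euclMeasurableEquiv N hN).symm a = (euclLinEquiv N hN).symm a :=
  rfl

/-- **The inverse image has squared norm `a* (N N*)⁻¹ a`**: `‖N⁻¹ a‖² = a* (N N*)⁻¹ a`.
[folklore] -/
theorem norm_sq_euclLinEquiv_symm (N : Matrix (Fin p) (Fin p) ℂ) (hN : N.det ≠ 0)
    (a : EuclideanSpace ℂ (Fin p)) :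
    ‖(euclLinEquiv N hN).symm a‖ ^ 2 = (star a.ofLp ⬝ᵥ (N * Nᴴ)⁻¹ *ᵥ a.ofLp).re := by
  set b := (euclLinEquiv N hN).symm a with hb
  have ha : a = WithLp.toLp 2 (N *ᵥ b.ofLp) := by
    rw [← euclLinEquiv_apply N hN, hb, LinearEquiv.apply_symm_apply]
  have hN' : IsUnit N.det := isUnit_iff_ne_zero.2 hN
  have hNH : IsUnit Nᴴ.det := by
    rw [det_conjTranspose]; exact hN'.star
  have key : star (N *ᵥ b.ofLp) ⬝ᵥ (N * Nᴴ)⁻¹ *ᵥ (N *ᵥ b.ofLp) = star b.ofLp ⬝ᵥ b.ofLp := by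
    rw [Matrix.mul_inv_rev, ← mulVec_mulVec, mulVec_mulVec _ N⁻¹ N, nonsing_inv_mul _ hN', one_mulVec,
      star_mulVec, dotProduct_mulVec, vecMul_vecMul, mul_nonsing_inv _ hNH, vecMul_one]
  rw [ha, WithLp.ofLp_toLp, key, EuclideanSpace.norm_sq_eq]
  simp only [dotProduct, Pi.star_apply, Complex.star_def, Complex.re_sum]
  refine Finset.sum_congr rfl fun i _ => ?_
  rw [Complex.conj_mul', ← Complex.ofReal_pow, Complex.ofReal_re]

/-- `|det N|² = det (N N*)` (as a real number). [folklore] -/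
theorem normSq_det_eq_det_mul_conjTranspose_re (N : Matrix (Fin p) (Fin p) ℂ) :
    Complex.normSq N.det = (N * Nᴴ).det.re := by
  rw [det_mul, det_conjTranspose, Complex.star_def, Complex.mul_conj, Complex.ofReal_re]

end Square

/-! ### Reduction of a `p × M` matrix to its action on `(ker)ᗮ` -/

section Reduce

variable {p r M : ℕ}

/-- **Completeness of an orthonormal basis** of `ℂ^M` in matrix form: `∑ₓ bₓ bₓ* = 1`.
[folklore] -/
theorem sum_vecMulVec_orthonormalBasis {ι : Type*} [Fintype ι]
    (B : OrthonormalBasis ι ℂ (EuclideanSpace ℂ (Fin M))) :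
    ∑ x, vecMulVec (B x).ofLp (star (B x).ofLp) = (1 : Matrix (Fin M) (Fin M) ℂ) := by
  ext l l'
  have h := B.sum_inner_mul_inner (EuclideanSpace.single l (1 : ℂ)) (EuclideanSpace.single l' (1 : ℂ))
  simp only [EuclideanSpace.inner_single_left, EuclideanSpace.inner_single_right, map_one, one_mul,
    PiLp.single_apply] at h
  rw [Matrix.sum_apply]
  simp only [vecMulVec_apply, Pi.star_apply, Complex.star_def, Matrix.one_apply]
  rw [h]
  by_cases hl : l = l'
  · subst hl; simp
  · simp [hl, Ne.symm hl]

/-- `N (v v*) N* = (N v)(N v)*`. [folklore] -/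
theorem mul_vecMulVec_mul_conjTranspose {m n : Type*} [Fintype m] [Fintype n]
    (N : Matrix m n ℂ) (v : n → ℂ) :
    N * vecMulVec v (star v) * Nᴴ = vecMulVec (N *ᵥ v) (star (N *ᵥ v)) := by
  rw [vecMulVec_eq Unit, vecMulVec_eq Unit, ← Matrix.mul_assoc, ← replicateCol_mulVec, Matrix.mul_assoc,
    ← replicateRow_vecMul, star_mulVec]

/-- `A A* = ∑ⱼ aⱼ aⱼ*` for the matrix `A` with columns `aⱼ`. [folklore] -/
theorem colMatrix_mul_conjTranspose {m : Type*} [Fintype m] {q : ℕ} (col : Fin q → m → ℂ) :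
    (Matrix.of fun i j => col j i) * (Matrix.of fun i j => col j i)ᴴ =
      ∑ j, vecMulVec (col j) (star (col j)) := by
  ext i k
  simp [Matrix.sum_apply, vecMulVec_apply, Matrix.mul_apply]

variable (N : Matrix (Fin p) (Fin M) ℂ) (B : OrthonormalBasis (Fin p ⊕ Fin r) ℂ (EuclideanSpace ℂ (Fin M)))

/-- The **reduced matrix** of `N : ℂ^M → ℂ^p` in an orthonormal basis `B` of `ℂ^M` indexed by
`Fin p ⊕ Fin r`: the `p × p` matrix whose columns are the images `N b_{inl i}`. When the `b_{inr k}`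
span `ker N`, this is the matrix of `N` restricted to `(ker N)ᗮ`. [folklore] -/
def reduce : Matrix (Fin p) (Fin p) ℂ :=
  Matrix.of fun i i' => (N *ᵥ (B (Sum.inl i')).ofLp) i

/-- If `N` kills the `b_{inr k}`, then `N c = N' u` where `u` are the `inl`-coordinates of `c`.
[folklore] -/
theorem reduce_mulVec (hB : ∀ k, N *ᵥ (B (Sum.inr k)).ofLp = 0) (c : EuclideanSpace ℂ (Fin M)) :
    N *ᵥ c.ofLp = reduce N B *ᵥ fun i' => B.repr c (Sum.inl i') := by
  conv_lhs => rw [← B.sum_repr c]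
  rw [WithLp.ofLp_sum, Matrix.mulVec_sum]
  simp only [WithLp.ofLp_smul, mulVec_smul, Fintype.sum_sum_type, hB, smul_zero, Finset.sum_const_zero,
    add_zero]
  ext i
  simp [reduce, mulVec, dotProduct, Finset.sum_apply, mul_comm]

/-- If `N` kills the `b_{inr k}`, then `N' N'* = N N*` (completeness of `B`). [folklore] -/
theorem reduce_mul_conjTranspose (hB : ∀ k, N *ᵥ (B (Sum.inr k)).ofLp = 0) :
    reduce N B * (reduce N B)ᴴ = N * Nᴴ := by
  symm
  calc N * Nᴴ = N * (∑ x, vecMulVec (B x).ofLp (star (B x).ofLp)) * Nᴴ := by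
        rw [sum_vecMulVec_orthonormalBasis, Matrix.mul_one]
    _ = ∑ x, N * vecMulVec (B x).ofLp (star (B x).ofLp) * Nᴴ := by
        rw [Matrix.mul_sum, Matrix.sum_mul]
    _ = ∑ x, vecMulVec (N *ᵥ (B x).ofLp) (star (N *ᵥ (B x).ofLp)) := by
        simp_rw [mul_vecMulVec_mul_conjTranspose]
    _ = ∑ i', vecMulVec (N *ᵥ (B (Sum.inl i')).ofLp) (star (N *ᵥ (B (Sum.inl i')).ofLp)) := by
        simp [Fintype.sum_sum_type, hB]
    _ = reduce N B * (reduce N B)ᴴ := by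
        rw [reduce, colMatrix_mul_conjTranspose]

variable {N}

/-- If `N N*` is positive definite then `N : ℂ^M → ℂ^p` is onto. [folklore] -/
theorem range_toEuclideanLin_eq_top (hC : (N * Nᴴ).PosDef) :
    LinearMap.range (toEuclideanLin N) = ⊤ := by
  rw [LinearMap.range_eq_top]
  intro y
  refine ⟨WithLp.toLp 2 (Nᴴ *ᵥ ((N * Nᴴ)⁻¹ *ᵥ y.ofLp)), ?_⟩
  change WithLp.toLp 2 (N *ᵥ (WithLp.toLp 2 (Nᴴ *ᵥ ((N * Nᴴ)⁻¹ *ᵥ y.ofLp))).ofLp) = y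
  rw [WithLp.ofLp_toLp, mulVec_mulVec, mulVec_mulVec,
    mul_nonsing_inv _ (isUnit_iff_ne_zero.2 hC.det_pos.ne'), one_mulVec, WithLp.toLp_ofLp]

/-- If `N N*` is positive definite then `dim ker N = M - p` and `dim (ker N)ᗮ = p`. [folklore] -/
theorem finrank_ker_toEuclideanLin (hC : (N * Nᴴ).PosDef) :
    finrank ℂ (LinearMap.ker (toEuclideanLin N)) = M - p ∧
      finrank ℂ (LinearMap.ker (toEuclideanLin N))ᗮ = p := by
  have h1 := LinearMap.finrank_range_add_finrank_ker (toEuclideanLin N)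
  rw [range_toEuclideanLin_eq_top hC, finrank_top, finrank_euclideanSpace, finrank_euclideanSpace,
    Fintype.card_fin, Fintype.card_fin] at h1
  have h2 := Submodule.finrank_add_finrank_orthogonal (LinearMap.ker (toEuclideanLin N))
  rw [finrank_euclideanSpace, Fintype.card_fin] at h2
  omega

end Reduce

/-! ### The conditional density -/

section CondDensity

variable {p : ℕ}

/-- The quadratic form `a* C⁻¹ a` (a real number when `C` is positive definite). [folklore] -/
def quadInv (C : Matrix (Fin p) (Fin p) ℂ) (a : EuclideanSpace ℂ (Fin p)) : ℝ :=
  (star a.ofLp ⬝ᵥ C⁻¹ *ᵥ a.ofLp).re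

/-- The **conditional density of a new corner column** given the Gram complement `C` of the
previous ones (exponent `e = m - p - q - 1`):
`(det C)⁻¹ (1 - a* C⁻¹ a)^e 𝟙_{a* C⁻¹ a < 1}`. [folklore] -/
def condDensity (e : ℕ) (C : Matrix (Fin p) (Fin p) ℂ) (a : EuclideanSpace ℂ (Fin p)) : ℝ :=
  if quadInv C a < 1 then (C.det.re)⁻¹ * (1 - quadInv C a) ^ e else 0

/-- `quadInv C` is continuous in `a`. [folklore] -/
theorem continuous_quadInv (C : Matrix (Fin p) (Fin p) ℂ) : Continuous (quadInv C) := by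
  unfold quadInv
  refine Complex.continuous_re.comp ?_
  simp only [dotProduct, mulVec]
  refine continuous_finsetSum _ fun i _ => Continuous.mul ?_ ?_
  · exact ((continuous_apply i).comp (PiLp.continuous_ofLp 2 _)).star
  · exact continuous_finsetSum _ fun j _ =>
      continuous_const.mul ((continuous_apply j).comp (PiLp.continuous_ofLp 2 _))

/-- The conditional density is measurable in `a`. [folklore] -/
@[fun_prop]
theorem measurable_condDensity (e : ℕ) (C : Matrix (Fin p) (Fin p) ℂ) :
    Measurable (condDensity e C) := by
  unfold condDensity
  refine Measurable.ite (measurableSet_lt (continuous_quadInv C).measurable measurable_const) ?_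
    measurable_const
  exact measurable_const.mul ((measurable_const.sub (continuous_quadInv C).measurable).pow_const _)

/-- `(x, a) ↦ a* C(x)⁻¹ a` is jointly measurable for a continuous matrix-valued `C`
(`C⁻¹ = (det C)⁻¹ adj C` entrywise; a rational function of the entries). [folklore] -/
theorem measurable_quadInv_comp {X : Type*} [TopologicalSpace X] [MeasurableSpace X]
    [OpensMeasurableSpace X] {C : X → Matrix (Fin p) (Fin p) ℂ} (hC : Continuous C) :
    Measurable fun x : X × EuclideanSpace ℂ (Fin p) => quadInv (C x.1) x.2 := by
  unfold quadInv
  refine Complex.measurable_re.comp ?_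
  -- entries of the inverse are measurable functions of the parameter
  have hinv : ∀ i j : Fin p, Measurable fun x : X => (C x)⁻¹ i j := by
    intro i j
    have h : (fun x : X => (C x)⁻¹ i j) = fun x => Ring.inverse (C x).det * (C x).adjugate i j := by
      funext x; rw [Matrix.inv_def, Matrix.smul_apply, smul_eq_mul]
    rw [h, Ring.inverse_eq_inv']
    refine Measurable.mul ?_ ?_
    · exact (hC.matrix_det).measurable.inv
    · exact ((hC.matrix_adjugate).matrix_elem i j).measurable
  simp only [dotProduct, mulVec]
  refine Finset.measurable_sum _ fun i _ => Measurable.mul ?_ ?_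
  · have h1 : Measurable fun x : X × EuclideanSpace ℂ (Fin p) => x.2.ofLp i :=
      (measurable_pi_apply i).comp ((WithLp.measurable_ofLp 2 _).comp measurable_snd)
    exact continuous_star.measurable.comp h1
  · refine Finset.measurable_sum _ fun j _ => Measurable.mul ?_ ?_
    · exact (hinv i j).comp measurable_fst
    · exact (measurable_pi_apply j).comp ((WithLp.measurable_ofLp 2 _).comp measurable_snd)

/-- The conditional density is jointly measurable in `(x, a)` along a continuous `C`. [folklore] -/
theorem measurable_condDensity_comp (e : ℕ) {X : Type*} [TopologicalSpace X] [MeasurableSpace X]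
    [OpensMeasurableSpace X] {C : X → Matrix (Fin p) (Fin p) ℂ} (hC : Continuous C) :
    Measurable fun x : X × EuclideanSpace ℂ (Fin p) => condDensity e (C x.1) x.2 := by
  unfold condDensity
  refine Measurable.ite (measurableSet_lt (measurable_quadInv_comp hC) measurable_const) ?_
    measurable_const
  refine Measurable.mul ?_ ((measurable_const.sub (measurable_quadInv_comp hC)).pow_const _)
  exact (Complex.measurable_re.comp ((hC.matrix_det).measurable.comp measurable_fst)).inv

/-- The conditional density is nonnegative when `det C > 0`. [folklore] -/
theorem condDensity_nonneg (e : ℕ) {C : Matrix (Fin p) (Fin p) ℂ} (hC : 0 ≤ C.det.re)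
    (a : EuclideanSpace ℂ (Fin p)) : 0 ≤ condDensity e C a := by
  unfold condDensity
  split_ifs with h
  · exact mul_nonneg (inv_nonneg.2 hC) (pow_nonneg (by linarith) _)
  · exact le_rfl

end CondDensity

/-! ### The conditional law -/

section CondLaw

variable {p M : ℕ}

/-- The normalised image `c ↦ ‖c‖⁻¹ · N c` of a vector of `ℂ^M` under a `p × M` matrix (junk value
`0` at `c = 0`). [folklore] -/
def normalizeMulVec (N : Matrix (Fin p) (Fin M) ℂ) (c : EuclideanSpace ℂ (Fin M)) :
    EuclideanSpace ℂ (Fin p) :=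
  ‖c‖⁻¹ • WithLp.toLp 2 (N *ᵥ c.ofLp)

/-- `normalizeMulVec N` is measurable. [folklore] -/
@[fun_prop]
theorem measurable_normalizeMulVec (N : Matrix (Fin p) (Fin M) ℂ) : Measurable (normalizeMulVec N) := by
  unfold normalizeMulVec
  refine Measurable.smul (measurable_norm.inv) ?_
  exact (toEuclideanLin N).continuous_of_finiteDimensional.measurable

/-- Real scalars pass through `N`: `r • N v = N (r • v)` on `ℂ^p`. [folklore] -/
theorem real_smul_toLp_mulVec {q : ℕ} (r : ℝ) (N : Matrix (Fin p) (Fin q) ℂ) (v : Fin q → ℂ) :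
    r • (WithLp.toLp 2 (N *ᵥ v) : EuclideanSpace ℂ (Fin p)) = WithLp.toLp 2 (N *ᵥ ((r : ℂ) • v)) := by
  rw [mulVec_smul]
  ext i
  simp [Complex.real_smul]

/-- **The conditional law of a new corner column.** For `M ≥ p + 1` there is a constant `K > 0`
(depending only on `p` and `M`) such that for every `p × M` matrix `N` with `C = N N*` positive
definite, the law of `‖c‖⁻¹ · N c` for a standard Gaussian vector `c` of `ℂ^M` is
`K · (det C)⁻¹ (1 - a* C⁻¹ a)^{M-p-1} 𝟙_{a* C⁻¹ a < 1} da` on `ℂ^p` (see the module docstring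
for the proof). [folklore] -/
theorem map_normalizeMulVec_stdGaussian (hpM : p + 1 ≤ M) :
    ∃ K : ℝ, 0 < K ∧ ∀ N : Matrix (Fin p) (Fin M) ℂ, (N * Nᴴ).PosDef →
      (stdGaussian (EuclideanSpace ℂ (Fin M))).map (normalizeMulVec N) =
        volume.withDensity fun a => ENNReal.ofReal (K * condDensity (M - p - 1) (N * Nᴴ) a) := by
  -- the sphere-marginal constant for `ℂ^p ⊕ ℂ^{M-p}`
  haveI : Nontrivial (EuclideanSpace ℂ (Fin (M - p))) := by
    have : 0 < M - p := by omega
    haveI : Nonempty (Fin (M - p)) := ⟨⟨0, this⟩⟩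
    infer_instance
  obtain ⟨K, hK0, hK⟩ := map_sphereMarginalMap_prod_stdGaussian
    (E₁ := EuclideanSpace ℂ (Fin p)) (F := EuclideanSpace ℂ (Fin (M - p)))
  refine ⟨K, hK0, fun N hC => ?_⟩
  -- Step 1: adapted orthonormal basis of `ℂ^M = (ker N)ᗮ ⊕ ker N`
  set T : EuclideanSpace ℂ (Fin M) →ₗ[ℂ] EuclideanSpace ℂ (Fin p) := toEuclideanLin N with hT
  set Kr : Submodule ℂ (EuclideanSpace ℂ (Fin M)) := LinearMap.ker T with hKr
  obtain ⟨hk1, hk2⟩ := finrank_ker_toEuclideanLin hC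
  have hk3 : finrank ℂ Krᗮᗮ = M - p := by rw [Submodule.orthogonal_orthogonal]; exact hk1
  let b₁ : OrthonormalBasis (Fin p) ℂ Krᗮ := (stdOrthonormalBasis ℂ Krᗮ).reindex (finCongr hk2)
  let b₂ : OrthonormalBasis (Fin (M - p)) ℂ Krᗮᗮ := (stdOrthonormalBasis ℂ Krᗮᗮ).reindex (finCongr hk3)
  let B : OrthonormalBasis (Fin p ⊕ Fin (M - p)) ℂ (EuclideanSpace ℂ (Fin M)) :=
    Krᗮ.sumOrthonormalBasis b₁ b₂
  have hB : ∀ k, N *ᵥ (B (Sum.inr k)).ofLp = 0 := by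
    intro k
    have hmem : (B (Sum.inr k)) ∈ Kr := by
      rw [show B (Sum.inr k) = (b₂ k : EuclideanSpace ℂ (Fin M)) from
        Krᗮ.sumOrthonormalBasis_apply_inr b₁ b₂ k]
      exact (Submodule.orthogonal_orthogonal Kr).le (b₂ k).2
    have h0 : T (B (Sum.inr k)) = 0 := LinearMap.mem_ker.1 hmem
    have h1 : N *ᵥ (B (Sum.inr k)).ofLp = (T (B (Sum.inr k))).ofLp := rfl
    rw [h1, h0]
    rfl
  -- Step 2: the reduced `p × p` matrix
  set N' : Matrix (Fin p) (Fin p) ℂ := reduce N B with hN'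
  have hNN : N' * N'ᴴ = N * Nᴴ := reduce_mul_conjTranspose N B hB
  have hdet : N'.det ≠ 0 := by
    intro h0
    have h1 : (N' * N'ᴴ).det = 0 := by rw [det_mul, h0, zero_mul]
    rw [hNN] at h1
    exact hC.det_pos.ne' h1
  -- Step 3: the map factorises as `N' ∘ sphereMarginalMap ∘ (coordinates in B)`
  have hfac : normalizeMulVec N =
      euclMeasurableEquiv N' hdet ∘
        sphereMarginalMap (EuclideanSpace ℂ (Fin p)) (EuclideanSpace ℂ (Fin (M - p))) ∘
          fun c => euclSplit (B.repr c) := by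
    funext c
    simp only [Function.comp_apply, euclMeasurableEquiv_apply, sphereMarginalMap, normalizeMulVec]
    -- the norm
    have hnorm : ‖c‖ = √(‖(euclSplit (B.repr c)).1‖ ^ 2 + ‖(euclSplit (B.repr c)).2‖ ^ 2) := by
      rw [← norm_sq_eq_euclSplit, B.repr.norm_map, Real.sqrt_sq (norm_nonneg _)]
    -- the matrix
    have hmul : N *ᵥ c.ofLp = N' *ᵥ (euclSplit (B.repr c)).1.ofLp := by
      rw [reduce_mulVec N B hB c]
      rfl
    rw [hmul, hnorm, WithLp.ofLp_smul, mulVec_smul, WithLp.toLp_smul]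
  -- Step 4: push the measures
  have hS : Measurable fun c : EuclideanSpace ℂ (Fin M) => euclSplit (B.repr c) :=
    (EuclideanSpace.sumEquivProd (𝕜 := ℂ) (ι := Fin p) (κ := Fin (M - p))).continuous.measurable.comp
          B.repr.continuous.measurable
  have hΦ : Measurable (sphereMarginalMap (EuclideanSpace ℂ (Fin p)) (EuclideanSpace ℂ (Fin (M - p)))) :=
    measurable_sphereMarginalMap
  rw [hfac, ← Measure.map_map (euclMeasurableEquiv N' hdet).measurable (hΦ.comp hS),
    ← Measure.map_map hΦ hS, map_euclSplit_repr_stdGaussian B, hK, map_withDensity_measurableEquiv]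
  have hvol : (volume : Measure (EuclideanSpace ℂ (Fin p))).map (euclMeasurableEquiv N' hdet) =
      ENNReal.ofReal ((Complex.normSq N'.det)⁻¹) • volume := map_toEuclideanLin_volume N' hdet
  rw [hvol, withDensity_smul_measure, ← withDensity_smul _ (by
    exact (ENNReal.measurable_ofReal.comp ((measurable_const.mul
      (measurable_sphereMarginalDensity _)))).comp (euclMeasurableEquiv N' hdet).symm.measurable)]
  -- Step 5: identify the density pointwise
  congr 1
  funext a
  simp only [Pi.smul_apply, smul_eq_mul, Function.comp_apply]
  have hq : ‖(euclMeasurableEquiv N' hdet).symm a‖ ^ 2 = quadInv (N * Nᴴ) a := by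
    rw [euclMeasurableEquiv_symm_apply, norm_sq_euclLinEquiv_symm, hNN]
    rfl
  have hdetC : (Complex.normSq N'.det)⁻¹ = ((N * Nᴴ).det.re)⁻¹ := by
    rw [normSq_det_eq_det_mul_conjTranspose_re, hNN]
  have hexp : ((finrank ℝ (EuclideanSpace ℂ (Fin (M - p))) : ℝ) / 2 - 1) = ((M - p - 1 : ℕ) : ℝ) := by
    rw [finrank_real_of_complex, finrank_euclideanSpace, Fintype.card_fin]
    have h1 : 1 ≤ M - p := by omega
    rw [Nat.cast_sub h1]
    push_cast
    ring
  have hK0' : 0 ≤ K := hK0.le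
  have hn0 : 0 ≤ (Complex.normSq N'.det)⁻¹ := inv_nonneg.2 (Complex.normSq_nonneg _)
  rw [← ENNReal.ofReal_mul hn0]
  congr 1
  unfold sphereMarginalDensity condDensity
  have hiff : ‖(euclMeasurableEquiv N' hdet).symm a‖ < 1 ↔ quadInv (N * Nᴴ) a < 1 := by
    rw [← hq, ← sq_lt_one_iff₀ (norm_nonneg _)]
  by_cases hlt : quadInv (N * Nᴴ) a < 1
  · rw [if_pos (hiff.2 hlt), if_pos hlt, hexp, Real.rpow_natCast, hq, hdetC]
    ring
  · rw [if_neg (fun h => hlt (hiff.1 h)), if_neg hlt]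
    simp

end CondLaw

end Literature.Probability.RandomMatrix
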